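import Literature.Computability.Complexity.Williams2014AccSat
import Literature.Computability.Complexity.Williams2014MachineB
import Literature.Computability.Complexity.QuasiPolyClock
import HarnessLib

/-!
# Williams' Lemma 4.1 (algorithmic `ACC → SYM⁺`): reduction of the machine clause to `FP`

`Williams2014AccSat.lean` states the algorithmic conversion lemma of R. Williams, *Nonuniform ACC
circuit lower bounds*, J. ACM 61 (2014), Lemma 4.1 with Appendix A, as the named fact
`Williams2014_lemma_4_1`: one `TM2` machine converts the code `encodeAccCircuit m C` of every
`AC⁰[m]` circuit of depth `≤ d` into the code `encodeSymPlus S` of an equivalent `SYM⁺` circuit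
of quasi-polynomial size, within `2^{(log₂ s + 2)^e}` steps. Its existence half is the tree's
theorem `Williams2014_symPlus_of_acc_holds`; what is open is the machine. This file PROVES the
machine-theoretic glue that reduces the fact to two purely combinatorial obligations, so that
its discharge needs no hand-built Turing machine and no running-time arithmetic:

* `Williams2014_lemma_4_1_of_quasiPoly` — it suffices to give, per `(d, m)`, an explicit map
  `S : Circuit (Fin n) → SymPlus n` with the printed bounds and ANY machine printing
  `encodeSymPlus (S C)` from `encodeAccCircuit m C` in time quasi-polynomial in the LENGTH of its
  input, `qpBound c k |input| = c · 2^{c (log₂ |input| + 2)^k} + c` (the code of a circuit with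
  `n ≤ s` inputs, `≤ s` gates and fan-in `≤ s` has length `≤ 17 (s + 2)³`,
  `length_encodeAccCircuit_le_cube`, from `MachineB.length_encodeAccCircuit_le` of
  `Williams2014MachineB.lean`; quasi-polynomials compose with polynomials,
  `qpBound_of_le_poly`, `qpBound_le_two_pow`);
* `exists_qp_machine_of_mem_FP` — **padding**: if `f ∈ FP` then `w ↦ f (qpClock c₁ e₁ w)` is
  computed by a `TM2` machine within `qpBound c (e₁ + 2) |w|` steps, by running the tree's
  quasi-polynomial clock machine (`exists_qpClock_machine`, `QuasiPolyClock.lean`: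
  `qpClock c₁ e₁ w = ⟨w, 1^{c₁ |w|^{(log₂ |w|)^{e₁}} + c₁}⟩`) and then the polynomial-time machine
  of `f` (`TM2ComputableAux.comp_outputsWithin`);
* `Williams2014_lemma_4_1_of_FP` — **the reduction**: `Williams2014_lemma_4_1` follows from, per
  `(d, m)`, an explicit `S` with the printed size / fan-in bounds and `S C ≡ C`, together with a
  polynomial-time string function `f ∈ FP` such that
  `f (qpClock c₁ e₁ (encodeAccCircuit m C)) = encodeSymPlus (S C)` for every circuit `C` over
  `accBasis m` of `acDepth ≤ d` (the unary pad is the budget that makes the quasi-polynomially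
  many seeds / monomials of the Beigel–Tarui conversion a polynomial-time loop in the padded
  length; `f` is meant to be assembled in the typed `CodeFP` algebra of `CodeFP.lean`).

This is the standard "an algorithm running in time `T(s)` is a polynomial-time algorithm on
inputs padded to length `T(s)`" device (Arora–Barak 2009, §2.6.2) applied to the printed claim
"The algorithm takes at most `s^{O(log^{f(d)} s)}` time" (Williams 2014, Lemma 4.1).

## What is NOT here

The explicit conversion `S` (Beigel–Tarui with Valiant–Vazirani seeds, majority over all seeds)
and the polynomial-time program `f`; see the unit NOTES of the review of `Williams2014_lemma_4_1`.
No new named fact is introduced; everything in this file is proved.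

## References

* R. Williams, *Nonuniform ACC circuit lower bounds*, J. ACM 61(1) (2014) 2:1–2:32, Lemma 4.1 and
  Appendix A [Williams2014].
* S. Arora, B. Barak, *Computational Complexity: A Modern Approach*, CUP 2009, §1.3 (composition
  of machines), §2.6.2 (padding) [AroraBarak2009].
-/

namespace Literature.Computability.Complexity

open _root_.Computability Turing

/-! ### Quasi-polynomial bounds in the input length -/

/-- The quasi-polynomial bounds used for running times and lengths:
`qpBound c k X = c · 2^{c (log₂ X + 2)^k} + c` (`log₂ = Nat.log 2`; the shift `+ 2` makes the
base `≥ 2`, so that constants are absorbed into exponents). [folklore] -/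
def qpBound (c k X : ℕ) : ℕ := c * 2 ^ (c * (Nat.log 2 X + 2) ^ k) + c

/-- `qpBound` is monotone in all three arguments. [folklore] -/
theorem qpBound_mono {c c' k k' X X' : ℕ} (hc : c ≤ c') (hk : k ≤ k') (hX : X ≤ X') :
    qpBound c k X ≤ qpBound c' k' X' := by
  unfold qpBound
  have hlog : Nat.log 2 X ≤ Nat.log 2 X' := Nat.log_mono_right hX
  have h1 : (Nat.log 2 X + 2) ^ k ≤ (Nat.log 2 X' + 2) ^ k' :=
    (Nat.pow_le_pow_left (by omega) k).trans (Nat.pow_le_pow_right (by omega) hk)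
  have h2 : 2 ^ (c * (Nat.log 2 X + 2) ^ k) ≤ 2 ^ (c' * (Nat.log 2 X' + 2) ^ k') :=
    Nat.pow_le_pow_right two_pos (Nat.mul_le_mul hc h1)
  exact Nat.add_le_add (Nat.mul_le_mul hc h2) hc

/-- Sums of quasi-polynomial bounds of the same exponent. [folklore] -/
theorem qpBound_add_le (a b k X : ℕ) : qpBound a k X + qpBound b k X ≤ qpBound (a + b) k X := by
  unfold qpBound
  set P := 2 ^ ((a + b) * (Nat.log 2 X + 2) ^ k) with hP
  have ha : 2 ^ (a * (Nat.log 2 X + 2) ^ k) ≤ P :=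
    Nat.pow_le_pow_right two_pos (Nat.mul_le_mul_right _ (Nat.le_add_right a b))
  have hb : 2 ^ (b * (Nat.log 2 X + 2) ^ k) ≤ P :=
    Nat.pow_le_pow_right two_pos (Nat.mul_le_mul_right _ (Nat.le_add_left b a))
  calc a * 2 ^ (a * (Nat.log 2 X + 2) ^ k) + a + (b * 2 ^ (b * (Nat.log 2 X + 2) ^ k) + b)
      ≤ a * P + a + (b * P + b) :=
        Nat.add_le_add (Nat.add_le_add_right (Nat.mul_le_mul_left a ha) a)
          (Nat.add_le_add_right (Nat.mul_le_mul_left b hb) b)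
    _ = (a + b) * P + (a + b) := by ring

/-- `c ≤ λ^c` once `λ ≥ 2`. [folklore] -/
private theorem le_pow_self_of_two_le {lam : ℕ} (h : 2 ≤ lam) (c : ℕ) : c ≤ lam ^ c :=
  (Nat.lt_two_pow_self).le.trans (Nat.pow_le_pow_left h c)

/-- `c · 2^A + c ≤ 2^{A + c + 1}`. [folklore] -/
private theorem mul_two_pow_add_le_succ (c A : ℕ) : c * 2 ^ A + c ≤ 2 ^ (A + c + 1) := by
  have hc : c ≤ 2 ^ c := (Nat.lt_two_pow_self).le
  have e1 : 2 ^ (A + c + 1) = 2 ^ c * 2 ^ A + 2 ^ c * 2 ^ A := by rw [pow_succ, pow_add]; ring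
  rw [e1]
  exact Nat.add_le_add (Nat.mul_le_mul_right _ hc)
    (hc.trans (Nat.le_mul_of_pos_right _ (Nat.two_pow_pos _)))

/-- **Constants are absorbed**: `qpBound c k X ≤ 2^{(log₂ X + 2)^{k + c + 2}}`, the form of the
time bound of `Williams2014_lemma_4_1`. [folklore] -/
theorem qpBound_le_two_pow (c k X : ℕ) :
    qpBound c k X ≤ 2 ^ (Nat.log 2 X + 2) ^ (k + c + 2) := by
  unfold qpBound
  set lam := Nat.log 2 X + 2 with hlam
  have h2 : 2 ≤ lam := by omega
  have h1 : 1 ≤ lam := by omega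
  refine (mul_two_pow_add_le_succ c _).trans (Nat.pow_le_pow_right two_pos ?_)
  have hck : c * lam ^ k ≤ lam ^ (k + c) := by
    rw [pow_add, mul_comm]
    exact Nat.mul_le_mul_left _ (le_pow_self_of_two_le h2 c)
  have hc1 : c + 1 ≤ lam ^ (k + c) :=
    Nat.lt_iff_add_one_le.1 ((Nat.lt_two_pow_self).trans_le
      ((Nat.pow_le_pow_left h2 c).trans (Nat.pow_le_pow_right h1 (Nat.le_add_left c k))))
  calc c * lam ^ k + c + 1 ≤ lam ^ (k + c) + lam ^ (k + c) := by omega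
    _ = 2 * lam ^ (k + c) := by ring
    _ ≤ lam * lam ^ (k + c) := Nat.mul_le_mul_right _ h2
    _ = lam ^ (k + c + 1) := by ring
    _ ≤ lam ^ (k + c + 2) := Nat.pow_le_pow_right h1 (by omega)

/-- **Polynomials of quasi-polynomials are quasi-polynomial** (same exponent `k`): if
`Y ≤ qpBound c k X` then `c₀ Y^j + c₀ ≤ qpBound c' k X` with `c' = c₀ + 2jc + j + 1`.
[folklore] -/
theorem poly_qpBound_le (c₀ j c k : ℕ) :
    ∃ c' : ℕ, ∀ X Y : ℕ, Y ≤ qpBound c k X → c₀ * Y ^ j + c₀ ≤ qpBound c' k X := by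
  refine ⟨c₀ + 2 * j * c + j + 1, fun X Y hY => ?_⟩
  unfold qpBound at hY ⊢
  set lam := Nat.log 2 X + 2 with hlam
  set L := lam ^ k with hL
  set c' := c₀ + 2 * j * c + j + 1 with hc'
  have hL1 : 1 ≤ L := Nat.one_le_pow _ _ (by omega)
  have hY' : Y ≤ 2 ^ (c * L + c + 1) := hY.trans (mul_two_pow_add_le_succ c _)
  have hexp : (c * L + c + 1) * j ≤ c' * L :=
    calc (c * L + c + 1) * j = j * c * L + (j * c + j) := by ring
      _ ≤ j * c * L + (j * c + j) * L :=
          Nat.add_le_add_left (Nat.le_mul_of_pos_right _ hL1) _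
      _ = (2 * j * c + j) * L := by ring
      _ ≤ c' * L := Nat.mul_le_mul_right _ (by omega)
  have hc₀ : c₀ ≤ c' := by omega
  calc c₀ * Y ^ j + c₀ ≤ c₀ * 2 ^ (c' * L) + c₀ := by
        refine Nat.add_le_add_right (Nat.mul_le_mul_left _ ?_) _
        calc Y ^ j ≤ (2 ^ (c * L + c + 1)) ^ j := Nat.pow_le_pow_left hY' j
          _ = 2 ^ ((c * L + c + 1) * j) := (pow_mul 2 _ j).symm
          _ ≤ 2 ^ (c' * L) := Nat.pow_le_pow_right two_pos hexp
    _ ≤ c' * 2 ^ (c' * L) + c' := Nat.add_le_add (Nat.mul_le_mul_right _ hc₀) hc₀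

/-- If `X ≤ c₀ (Z + 2)^j` then `log₂ X + 2 ≤ (c₀ + j + 1) (log₂ Z + 2)`. [folklore] -/
theorem log_add_two_le_of_le_poly {c₀ j X Z : ℕ} (h : X ≤ c₀ * (Z + 2) ^ j) :
    Nat.log 2 X + 2 ≤ (c₀ + j + 1) * (Nat.log 2 Z + 2) := by
  set lam := Nat.log 2 Z + 2 with hlam
  have h2 : 2 ≤ lam := by omega
  have hZ : Z + 2 ≤ 2 ^ lam := by
    have h1 : Z < 2 ^ (Nat.log 2 Z + 1) := Nat.lt_pow_succ_log_self one_lt_two Z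
    have h3 : 2 ^ lam = 2 ^ (Nat.log 2 Z + 1) + 2 ^ (Nat.log 2 Z + 1) := by
      rw [hlam, pow_succ]; ring
    have h4 : 2 ≤ 2 ^ (Nat.log 2 Z + 1) := by
      rw [pow_succ]; have := Nat.one_le_two_pow (n := Nat.log 2 Z); omega
    omega
  have hX : X < 2 ^ (c₀ + lam * j) :=
    calc X ≤ c₀ * (Z + 2) ^ j := h
      _ ≤ c₀ * 2 ^ (lam * j) :=
          Nat.mul_le_mul_left _ (by rw [pow_mul]; exact Nat.pow_le_pow_left hZ j)
      _ < 2 ^ c₀ * 2 ^ (lam * j) := mul_lt_mul_of_pos_right (Nat.lt_two_pow_self) (Nat.two_pow_pos _)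
      _ = 2 ^ (c₀ + lam * j) := (pow_add 2 _ _).symm
  have hc₀ : c₀ ≤ c₀ * lam := Nat.le_mul_of_pos_right _ (by omega)
  rcases Nat.eq_zero_or_pos X with hx | hx
  · rw [hx, Nat.log_zero_right]
    calc 0 + 2 ≤ lam := by omega
      _ = 1 * lam := (one_mul _).symm
      _ ≤ (c₀ + j + 1) * lam := Nat.mul_le_mul_right _ (by omega)
  · have hlog : Nat.log 2 X < c₀ + lam * j := Nat.log_lt_of_lt_pow hx.ne' hX
    calc Nat.log 2 X + 2 ≤ c₀ + lam * j + 2 := by omega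
      _ ≤ c₀ * lam + lam * j + lam := by omega
      _ = (c₀ + j + 1) * lam := by ring

/-- **Change of variable**: a quasi-polynomial in a polynomially bounded quantity is a
quasi-polynomial (same exponent `k`, constant `c (c₀ + j + 1)^k`). [folklore] -/
theorem qpBound_of_le_poly (c k c₀ j : ℕ) :
    ∃ c' : ℕ, ∀ X Z : ℕ, X ≤ c₀ * (Z + 2) ^ j → qpBound c k X ≤ qpBound c' k Z := by
  refine ⟨c * (c₀ + j + 1) ^ k, fun X Z h => ?_⟩
  have hA : 1 ≤ (c₀ + j + 1) ^ k := Nat.one_le_pow _ _ (by omega)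
  have hlog := log_add_two_le_of_le_poly h
  have hpow : (Nat.log 2 X + 2) ^ k ≤ (c₀ + j + 1) ^ k * (Nat.log 2 Z + 2) ^ k := by
    rw [← mul_pow]; exact Nat.pow_le_pow_left hlog k
  have hc : c ≤ c * (c₀ + j + 1) ^ k := Nat.le_mul_of_pos_right _ hA
  unfold qpBound
  refine Nat.add_le_add (Nat.mul_le_mul hc (Nat.pow_le_pow_right two_pos ?_)) hc
  calc c * (Nat.log 2 X + 2) ^ k ≤ c * ((c₀ + j + 1) ^ k * (Nat.log 2 Z + 2) ^ k) :=
        Nat.mul_le_mul_left _ hpow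
    _ = c * (c₀ + j + 1) ^ k * (Nat.log 2 Z + 2) ^ k := (mul_assoc _ _ _).symm

/-! ### The padded input and its machine -/

/-- The quasi-polynomial pad is quasi-polynomially long:
`|qpClock c₁ e₁ w| ≤ qpBound (c₁ + 2) (e₁ + 1) |w|`. [folklore] -/
theorem length_qpClock_le (c₁ e₁ : ℕ) (w : List Bool) :
    (qpClock c₁ e₁ w).length ≤ qpBound (c₁ + 2) (e₁ + 1) w.length := by
  unfold qpClock qpBound
  rw [length_boolPair, List.length_replicate]
  set N := w.length with hN
  set lam := Nat.log 2 N + 2 with hlam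
  set L := lam ^ (e₁ + 1) with hL
  have hNlt : N < 2 ^ (Nat.log 2 N + 1) := Nat.lt_pow_succ_log_self one_lt_two N
  have h1 : 1 ≤ lam := by omega
  have hpow : N ^ Nat.log 2 N ^ e₁ ≤ 2 ^ L :=
    calc N ^ Nat.log 2 N ^ e₁ ≤ (2 ^ (Nat.log 2 N + 1)) ^ Nat.log 2 N ^ e₁ :=
          Nat.pow_le_pow_left hNlt.le _
      _ = 2 ^ ((Nat.log 2 N + 1) * Nat.log 2 N ^ e₁) := (pow_mul _ _ _).symm
      _ ≤ 2 ^ L := Nat.pow_le_pow_right two_pos (by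
          rw [hL, pow_succ']
          exact Nat.mul_le_mul (by omega) (Nat.pow_le_pow_left (by omega) _))
  have h2N : 2 * N + 2 ≤ 2 ^ L + 1 := by
    have hlamL : lam ≤ L := by rw [hL]; exact Nat.le_self_pow (by omega) lam
    have h2lam : 2 ^ lam = 2 * 2 ^ (Nat.log 2 N + 1) := by rw [hlam, pow_succ]; ring
    have : 2 ^ lam ≤ 2 ^ L := Nat.pow_le_pow_right two_pos hlamL
    omega
  have hcL : 2 ^ L ≤ 2 ^ ((c₁ + 2) * L) :=
    Nat.pow_le_pow_right two_pos (Nat.le_mul_of_pos_left _ (by omega))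
  calc 2 * N + 2 + (c₁ * N ^ Nat.log 2 N ^ e₁ + c₁) ≤ 2 ^ L + 1 + (c₁ * 2 ^ L + c₁) :=
        Nat.add_le_add h2N (Nat.add_le_add_right (Nat.mul_le_mul_left _ hpow) _)
    _ = (c₁ + 1) * 2 ^ L + (c₁ + 1) := by ring
    _ ≤ (c₁ + 2) * 2 ^ ((c₁ + 2) * L) + (c₁ + 2) :=
        Nat.add_le_add (Nat.mul_le_mul (Nat.le_succ _) hcL) (Nat.le_succ _)

/-- **Padding a polynomial-time function by the quasi-polynomial clock.** If `f ∈ FP` then some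
`TM2` machine maps every word `w` to `f (qpClock c₁ e₁ w)` within `qpBound c (e₁ + 2) |w|` steps:
run the clock machine of `QuasiPolyClock.lean` (`exists_qpClock_machine`, time
`C · 2^{(log₂ |w|)^{e₁ + 2}} + C`), then the machine of `f` (polynomial in the padded length
`|qpClock c₁ e₁ w| ≤ qpBound (c₁+2) (e₁+1) |w|`), by sequential composition
(`TM2ComputableAux.comp_outputsWithin`). (Arora–Barak 2009, §2.6.2: padding; §1.3: composition.)
[cite: AroraBarak2009, §2.6.2] -/
theorem exists_qp_machine_of_mem_FP {f : List Bool → List Bool} (hf : f ∈ FP) (c₁ e₁ : ℕ) :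
    ∃ (c : ℕ) (M : TM2ComputableAux Bool Bool), ∀ w : List Bool,
      M.OutputsWithin w (f (qpClock c₁ e₁ w)) (qpBound c (e₁ + 2) w.length) := by
  obtain ⟨C, N, hN⟩ := exists_qpClock_machine c₁ e₁
  obtain ⟨p, F, hF⟩ := hf
  obtain ⟨cp, jp, hp⟩ := exists_eval_le_mul_pow_add p
  obtain ⟨c', hc'⟩ := poly_qpBound_le cp jp (c₁ + 2) (e₁ + 2)
  refine ⟨c' + (C + 1), N.comp F, fun w => ?_⟩
  have h2 : F.OutputsWithin (qpClock c₁ e₁ w) (f (qpClock c₁ e₁ w))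
      (p.eval (qpClock c₁ e₁ w).length) := hF _
  have h := TM2ComputableAux.comp_outputsWithin N F (hN w) h2
  refine h.mono ?_
  have hlen : (qpClock c₁ e₁ w).length ≤ qpBound (c₁ + 2) (e₁ + 2) w.length :=
    (length_qpClock_le c₁ e₁ w).trans (qpBound_mono le_rfl (Nat.le_succ _) le_rfl)
  have hA : p.eval (qpClock c₁ e₁ w).length ≤ qpBound c' (e₁ + 2) w.length :=
    (hp _).trans (hc' _ _ hlen)
  have hB : C * 2 ^ Nat.log 2 w.length ^ (e₁ + 2) + C ≤ qpBound (C + 1) (e₁ + 2) w.length := by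
    unfold qpBound
    have : Nat.log 2 w.length ^ (e₁ + 2) ≤ (C + 1) * (Nat.log 2 w.length + 2) ^ (e₁ + 2) :=
      (Nat.pow_le_pow_left (Nat.le_add_right _ 2) _).trans
        (Nat.le_mul_of_pos_left _ (Nat.succ_pos C))
    exact Nat.add_le_add (Nat.mul_le_mul (Nat.le_succ C) (Nat.pow_le_pow_right two_pos this))
      (Nat.le_succ C)
  exact (Nat.add_le_add hA hB).trans (qpBound_add_le _ _ _ _)

/-! ### The length of the code of a circuit -/

/-- **The code of a circuit is polynomially long**, single-parameter form of
`MachineB.length_encodeAccCircuit_le` (`Williams2014MachineB.lean`): with `n ≤ s` inputs, at most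
`s` gates and fan-in `≤ s`, `|encodeAccCircuit m C| ≤ MachineB.codeLen s s s ≤ 17 (s + 2)³`.
[folklore] -/
theorem length_encodeAccCircuit_le_cube {m n s : ℕ} (C : Circuit (Fin n)) (hn : n ≤ s)
    (hsize : C.size ≤ s) (hfan : C.maxFanIn ≤ s) :
    (encodeAccCircuit m C).length ≤ 17 * (s + 2) ^ 3 := by
  have h := (MachineB.length_encodeAccCircuit_le m C hsize hfan).trans
    (MachineB.codeLen_mono hn le_rfl le_rfl)
  refine h.trans ?_
  unfold MachineB.codeLen
  have h1 : 4 + s * (2 * s + 2) ≤ 2 * (s + 2) ^ 2 := by nlinarith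
  have h2 : 2 * (s + s + s) + 14 ≤ 8 * (s + 2) := by omega
  have hP : 8 ≤ (s + 2) ^ 3 :=
    calc 8 = 2 ^ 3 := rfl
      _ ≤ (s + 2) ^ 3 := Nat.pow_le_pow_left (by omega) 3
  calc 2 + (4 + s * (2 * s + 2)) * (2 * (s + s + s) + 14)
      ≤ 2 + 2 * (s + 2) ^ 2 * (8 * (s + 2)) := Nat.add_le_add_left (Nat.mul_le_mul h1 h2) _
    _ = 2 + 16 * (s + 2) ^ 3 := by ring
    _ ≤ 17 * (s + 2) ^ 3 := by omega

/-! ### The reduction of Lemma 4.1 -/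

/-- **Lemma 4.1 from an explicit conversion and any quasi-polynomial machine for it.** If for
every depth `d` and modulus `m ≥ 2` there are an explicit map `S` from circuits to `SYM⁺`
circuits with the printed size and fan-in bounds and `S C ≡ C` (for circuits over `accBasis m`
of `acDepth ≤ d` on `n ≤ s` inputs with `≤ s` gates of fan-in `≤ s`), and a `TM2` machine
printing `encodeSymPlus (S C)` from `encodeAccCircuit m C` within `qpBound c k |encodeAccCircuit m C|`
steps, then `Williams2014_lemma_4_1` holds: the code has length `≤ 17 (s+2)³`
(`length_encodeAccCircuit_le_cube`), so the time is `≤ 2^{(log₂ s + 2)^e}` for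
`e = k + c' + 2` (`qpBound_of_le_poly`, `qpBound_le_two_pow`). (Williams 2014, Lemma 4.1: "The
algorithm takes at most `s^{O(log^{f(d)} s)}` time.") [cite: Williams2014, Lemma 4.1 and Appendix A] -/
theorem Williams2014_lemma_4_1_of_quasiPoly
    (H : ∀ d m : ℕ, 2 ≤ m → ∃ (S : ∀ {n : ℕ}, Circuit (Fin n) → SymPlus n) (e₀ c k : ℕ)
        (M : TM2ComputableAux Bool Bool),
      (∀ (n s : ℕ) (C : Circuit (Fin n)), C.IsOver (accBasis m) → C.acDepth ≤ d → n ≤ s →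
          C.size ≤ s → C.maxFanIn ≤ s →
        (S C).size ≤ 2 ^ (Nat.log 2 s + 2) ^ e₀ ∧ (S C).maxFanIn ≤ (Nat.log 2 s + 2) ^ e₀ ∧
          ∀ x, (S C).eval x = C.eval x) ∧
      (∀ (n : ℕ) (C : Circuit (Fin n)), C.IsOver (accBasis m) → C.acDepth ≤ d →
        M.OutputsWithin (encodeAccCircuit m C) (encodeSymPlus (S C))
          (qpBound c k (encodeAccCircuit m C).length))) :
    Williams2014_lemma_4_1 := by
  intro d m hm
  obtain ⟨S, e₀, c, k, M, hS, hM⟩ := H d m hm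
  obtain ⟨c', hc'⟩ := qpBound_of_le_poly c k 17 3
  refine ⟨max e₀ (k + c' + 2), M, fun n s C hO hd hn hsz hf => ?_⟩
  obtain ⟨h1, h2, h3⟩ := hS n s C hO hd hn hsz hf
  have hlam : 1 ≤ Nat.log 2 s + 2 := by omega
  have hpow : (Nat.log 2 s + 2) ^ e₀ ≤ (Nat.log 2 s + 2) ^ max e₀ (k + c' + 2) :=
    Nat.pow_le_pow_right hlam (le_max_left _ _)
  refine ⟨S C, h1.trans (Nat.pow_le_pow_right two_pos hpow), h2.trans hpow, h3,
    (hM n C hO hd).mono ?_⟩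
  calc qpBound c k (encodeAccCircuit m C).length
      ≤ qpBound c' k s := hc' _ _ (length_encodeAccCircuit_le_cube C hn hsz hf)
    _ ≤ 2 ^ (Nat.log 2 s + 2) ^ (k + c' + 2) := qpBound_le_two_pow c' k s
    _ ≤ 2 ^ (Nat.log 2 s + 2) ^ max e₀ (k + c' + 2) :=
        Nat.pow_le_pow_right two_pos (Nat.pow_le_pow_right hlam (le_max_right _ _))

/-- **Williams' Lemma 4.1 reduces to an explicit conversion computed in `FP` on padded codes.**
Suppose that for every depth `d` and modulus `m ≥ 2` there are: an explicit map `S` from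
circuits `C : Circuit (Fin n)` to `SYM⁺` circuits with `(S C).size ≤ 2^{(log₂ s + 2)^{e₀}}`,
`(S C).maxFanIn ≤ (log₂ s + 2)^{e₀}` and `S C ≡ C` whenever `C` is over `accBasis m` of
`acDepth ≤ d` on `n ≤ s` inputs with `≤ s` gates of fan-in `≤ s`; constants `c₁, e₁`; and a
polynomial-time string function `f ∈ FP` with
`f (qpClock c₁ e₁ (encodeAccCircuit m C)) = encodeSymPlus (S C)` for every circuit `C` over
`accBasis m` of `acDepth ≤ d` (the quasi-polynomial unary pad `qpClock` of `QuasiPolyClock.lean`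
being the budget of the conversion). Then `Williams2014_lemma_4_1` holds, the machine being
"write the pad, then run `f`" (`exists_qp_machine_of_mem_FP`, `Williams2014_lemma_4_1_of_quasiPoly`).
This is the printed "algorithm … in `s^{O(log^{f(d)} s)}` time" read through padding
(Arora–Barak 2009, §2.6.2). [cite: Williams2014, Lemma 4.1 and Appendix A] -/
theorem Williams2014_lemma_4_1_of_FP
    (H : ∀ d m : ℕ, 2 ≤ m → ∃ (S : ∀ {n : ℕ}, Circuit (Fin n) → SymPlus n) (e₀ c₁ e₁ : ℕ)
        (f : List Bool → List Bool), f ∈ FP ∧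
      (∀ (n s : ℕ) (C : Circuit (Fin n)), C.IsOver (accBasis m) → C.acDepth ≤ d → n ≤ s →
          C.size ≤ s → C.maxFanIn ≤ s →
        (S C).size ≤ 2 ^ (Nat.log 2 s + 2) ^ e₀ ∧ (S C).maxFanIn ≤ (Nat.log 2 s + 2) ^ e₀ ∧
          ∀ x, (S C).eval x = C.eval x) ∧
      (∀ (n : ℕ) (C : Circuit (Fin n)), C.IsOver (accBasis m) → C.acDepth ≤ d →
        f (qpClock c₁ e₁ (encodeAccCircuit m C)) = encodeSymPlus (S C))) :
    Williams2014_lemma_4_1 := by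
  refine Williams2014_lemma_4_1_of_quasiPoly fun d m hm => ?_
  obtain ⟨S, e₀, c₁, e₁, f, hf, hS, hfS⟩ := H d m hm
  obtain ⟨c, M, hM⟩ := exists_qp_machine_of_mem_FP hf c₁ e₁
  exact ⟨S, e₀, c, e₁ + 2, M, hS, fun n C hO hd => by rw [← hfS n C hO hd]; exact hM _⟩

end Literature.Computability.Complexity
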